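import Literature.Geometry.Lorentzian.BoundedGeometry
import Literature.Geometry.Lorentzian.NearKerrLeaf
import HarnessLib

/-!
# Asymptotically stationary exhaustions of a black-hole exterior (family `gr`, summit
`FinalStateConjecture`, route `TwoBoundarySqueeze`)

The folklore expectation behind the final state conjecture is that the exterior of a black
hole formed in gravitational collapse "settles down to a stationary final state" (Wald 1984,
Ch. 12, introduction; the stationary final states are then classified by black-hole uniqueness,
and Alexakis–Schlue, J. Differential Geom. 108 (2018), Thm. 1.1, prove the infinite-window
vacuum version "time-periodic near `𝓘⁺` ⇒ stationary near `𝓘⁺`"). This file vendors the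
**consequence-form, chart-based** rendering of the intermediate notion "the exterior is
asymptotically stationary in `Cᵏ`, exhaustively" requested by route
`FinalStateConjecture/TwoBoundarySqueeze` (to split its crux `SqueezeToKerrFamilyC0` into an
observability statement — complete `𝓘⁺` ⇒ asymptotically stationary exhaustion — and a
rigidity statement — asymptotically stationary exhaustion ⇒ `FinalStateDecomposition`), in the
vocabulary of `KerrConvergence.lean` (DHRT arXiv:2104.08222, §1: late-time charts from open
domains of `E4`, `Cᵏ` sup norms over coordinate slabs `{x⁰ = τ}`). No printed formulation of the
notion exists; like `FinalStateDecomposition` it is a hypothesis structure recording what the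
route's statements consume.

* Generic layer over a `ModelBackground` `B` whose time function is `x⁰` (`Kerr.background`,
  `Minkowski.backgroundOn U`), on top of `Spacetime.chartMetric` / `chartMetricCk`
  (`BoundedGeometry.lean`): `Spacetime.deviationTimeDeriv` (`∂₀ (Ψ^* g − g₀)`: the derivative of
  `deviationExtend` along `E4.basisVector 0 = EuclideanSpace.single 0 1`),
  `Spacetime.stationarityCk` / `truncStationarityCk` (its `Cᵏ` sup norm over full / truncated
  slabs), `Spacetime.IsUniformlyRegularOn` (uniform control of a chart on a set of chart points).
* `AsymptoticallyStationaryExhaustion 𝓢 O k` (style of `FinalStateDecomposition`): `N` near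
  charts and one far chart from open domains of `E4`, bookkept by `Minkowski.backgroundOn U`
  (time `x⁰`, radius `|x̲|`, reference `η` — constant, so `∂₀` of the deviation is `∂₀ (Ψ^* g)`),
  all `IsLateChart` into `O` after a common `τ₀`; (a) uniform control in `C^{k+1}` and
  (b) `Cᵏ`-stationarity `→ 0` on every truncated slab of each near chart and on the full slabs of
  the far chart; (c) exhaustion: radii `Rᵢ(τ)` along which (a), (b) still hold and, for every
  chart time `τ₁ > τ₀`, the covering clause of `Summit.FinalStateConjecture.HasExhaustiveCharts`.
* Over the repaired development structure (`CauchyDevelopment.exteriorOf` of `NearKerrLeaf.lean`,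
  definitionally `Summit.FinalStateConjecture.exteriorOf`):
  `CauchyDevelopment.HasAsymptoticallyStationaryExhaustion 𝒟 k` — some `O` carries an exhaustion
  in `Cᵏ` and **is** the exterior its charts determine, `O = J⁺(ι X) ∩ I⁻(charted)`.

## Design choices (what the clauses forbid)

* **No reference metric, so the chart is pinned by (a).** Stationarity is decay of `∂₀ (Ψ^* g)`
  in the chart's own time; without (a) one could slow the chart clock (`t = log x⁰` makes every
  `∂₀`-derivative decay while `Ψ^* g` degenerates). Clause (a) asks, with one constant `C`,
  eventually in `τ`: `‖∂^m (Ψ^* g)‖ ≤ C` on the slab for `m ≤ k + 1`; `‖v‖ ≤ C ‖(Ψ^* g)(x) v‖`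
  (inverse metric bounded: the requested uniform non-degeneracy); and `‖v‖² ≤ C (Ψ^* g)(x)(v, v)`
  for `v⁰ = 0` (slabs uniformly spacelike). The last sub-clause is not in the informal request but
  is forced by it: otherwise exchanging `x⁰` with a spatial coordinate of an asymptotically flat
  chart turns *flatness at spatial infinity* into "stationarity", and (c) holds trivially because
  the causal past of a timelike hyperplane is everything.
* **No orientation clause**, as in `FinalStateDecomposition`: over a Cauchy development the
  exhaustion clause (c) with `O = J⁺(ι X) ∩ I⁻(charted)` already prevents time-reversed charts from
  certifying late points.
* **Far chart untruncated, near charts truncated**, exactly as the flat / hole charts of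
  `FinalStateDecomposition` and `HasExhaustiveCharts`: the far slabs `{x⁰ = τ}` reach spatial
  infinity, which no bounded certified slab causally precedes.
* **Eventual bounds** (`∀ᶠ τ in atTop`) in (a): the clauses concern `τ → ∞` only, and `τ₀` (hence
  `O`) need not be moved when an exhaustion is built from a converging decomposition.
* **Expected sanity statement** (companion `AsymptoticallyStationaryExhaustionFlat.lean` proves the
  case `N = 0`; TODO(general form)): a `FinalStateDecomposition` in `C^{k+1}` with exhaustive
  charts yields an exhaustion in `Cᵏ` — far chart = flat chart; near chart `i` = hole chart `i`
  precomposed with the Poincaré map `y ↦ Λᵢ y + cᵢ` (boosted Kerr is the stationary Kerr–Schild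
  form in its rest frame) and with the stationary reparametrisation
  `y̲ ↦ (y₁ − a y₂/|y̲|, y₂ + a y₁/|y̲|, y₃)` under which the bookkeeping radius `|y̲|` becomes the
  Kerr–Schild radius `r`, so that truncated slabs correspond exactly.

## References

* R. M. Wald, *General Relativity*, Chicago 1984, Ch. 12, introduction (key `Wald1984`).
* S. Alexakis, V. Schlue, J. Differential Geom. 108 (2018) 1–62 = arXiv:1504.04592, Thm. 1.1
  (key `AlexakisSchlue2018`).
* M. Dafermos, G. Holzegel, I. Rodnianski, M. Taylor, arXiv:2104.08222, §1 (`arXiv210408222`).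
* M. Dafermos, J. Luk, arXiv:1710.01722, Conjecture 1 (`DafermosLuk2017`).
-/

noncomputable section

open TopologicalSpace Manifold Filter Topology Set
open scoped ContDiff Topology ENNReal NNReal

universe u

namespace Literature.Geometry.Lorentzian

/-! ### Generic layer: chart metric, `∂₀` of the deviation, stationarity norms, uniform control -/

namespace Spacetime

variable (𝓢 : Spacetime.{u} 4) (B : ModelBackground)

/-- **`∂₀` of the metric deviation**: the derivative of the extended deviation
`Ψ^* g − g₀` (`deviationExtend`) along the chart time direction `∂₀ = E4.basisVector 0`
(`= EuclideanSpace.single 0 1`). For a stationary reference (`∂₀ g₀ = 0` on the domain: `η`,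
Kerr–Schild `g_{M,a}`) this is `∂₀ (Ψ^* g)` on the domain, i.e. the Lie derivative of `Ψ^* g` along
the candidate Killing field `∂₀` (Alexakis–Schlue 2018, §1: stationary = the time translation is
induced by a Killing field). [cite: AlexakisSchlue2018, Thm. 1.1] -/
def deviationTimeDeriv (Ψ : B.domain → 𝓢.carrier) (x : E4) : E4 →L[ℝ] E4 →L[ℝ] ℝ :=
  fderiv ℝ (𝓢.deviationExtend B Ψ) x (E4.basisVector 0)

/-- The **`Cᵏ` stationarity norm on the slab `{t = τ}`**:
`sup_{m ≤ k} sup_{x ∈ U, t(x) = τ} ‖D^m ∂₀ (Ψ^* g − g₀)(x)‖ ∈ [0, ∞]`; "asymptotically stationary in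
`Cᵏ`" means that it tends to `0` as `τ → ∞` (consequence form, DHRT arXiv:2104.08222, §1, of
"settles down to a stationary state", Wald 1984, Ch. 12). [cite: Wald1984, Ch. 12] -/
def stationarityCk (Ψ : B.domain → 𝓢.carrier) (k : ℕ) (τ : ℝ) : ℝ≥0∞ :=
  supCkENorm (Subtype.val '' B.timeSlab τ) k (𝓢.deviationTimeDeriv B Ψ)

/-- The **`Cᵏ` stationarity norm on the truncated slab `{t = τ, r ≤ R}`** (near-zone version of
`stationarityCk`). [cite: Wald1984, Ch. 12] -/
def truncStationarityCk (Ψ : B.domain → 𝓢.carrier) (k : ℕ) (R τ : ℝ) : ℝ≥0∞ :=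
  supCkENorm (Subtype.val '' B.truncTimeSlab R τ) k (𝓢.deviationTimeDeriv B Ψ)

/-- The truncated stationarity norm is bounded by the full one. [folklore] -/
theorem truncStationarityCk_le_stationarityCk (Ψ : B.domain → 𝓢.carrier) (k : ℕ) (R τ : ℝ) :
    𝓢.truncStationarityCk B Ψ k R τ ≤ 𝓢.stationarityCk B Ψ k τ :=
  supCkENorm_mono (image_mono (B.truncTimeSlab_subset_timeSlab R τ)) _ _

/-- The truncated stationarity norm is monotone in `R`. [folklore] -/
theorem truncStationarityCk_mono (Ψ : B.domain → 𝓢.carrier) (k : ℕ) {R R' : ℝ} (h : R ≤ R')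
    (τ : ℝ) : 𝓢.truncStationarityCk B Ψ k R τ ≤ 𝓢.truncStationarityCk B Ψ k R' τ :=
  supCkENorm_mono (image_mono (B.truncTimeSlab_mono h τ)) _ _

/-- The stationarity norm is monotone in `k`. [folklore] -/
theorem stationarityCk_mono_right (Ψ : B.domain → 𝓢.carrier) {k k' : ℕ} (h : k ≤ k') (τ : ℝ) :
    𝓢.stationarityCk B Ψ k τ ≤ 𝓢.stationarityCk B Ψ k' τ :=
  supCkENorm_mono_right _ h _

/-- The truncated stationarity norm is monotone in `k`. [folklore] -/
theorem truncStationarityCk_mono_right (Ψ : B.domain → 𝓢.carrier) {k k' : ℕ} (h : k ≤ k')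
    (R τ : ℝ) : 𝓢.truncStationarityCk B Ψ k R τ ≤ 𝓢.truncStationarityCk B Ψ k' R τ :=
  supCkENorm_mono_right _ h _

/-- **Uniform control of a chart on a set `S` of chart points, with constant `C`, in `C^m`**
(clause (a) of an asymptotically stationary exhaustion): `‖∂^j (Ψ^* g)‖ ≤ C` on `S` for `j ≤ m`
(`chartMetricCk`, bounded geometry in the chart); the chart metric is uniformly non-degenerate,
`‖v‖ ≤ C ‖(Ψ^* g)(x) v‖` (operator norm of the inverse at most `C`: the lapse is bounded below, the
chart clock cannot be slowed down); the coordinate slabs `{x⁰ = const}` are uniformly spacelike,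
`‖v‖² ≤ C (Ψ^* g)(x)(v, v)` for `v⁰ = 0` (the chart time cannot be exchanged with a space
coordinate). Uniformity of spatial metric / lapse / shift of the `3 + 1` split (Wald 1984, §10.2,
(10.2.10)–(10.2.12)); compare `Spacetime.HasBoundedGeometryOn` (`BoundedGeometry.lean`: order `2`,
and `∂₀` uniformly timelike instead of the inverse bound — too strong here, `∂₀` being spacelike in
a Kerr ergoregion). [cite: Wald1984, §10.2, (10.2.10)–(10.2.12)] -/
structure IsUniformlyRegularOn (Ψ : B.domain → 𝓢.carrier) (m : ℕ) (C : ℝ≥0) (S : Set B.domain) :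
    Prop where
  /-- `C^m` bound of the chart metric `Ψ^* g` over `S` (`chartMetricCk`, `BoundedGeometry.lean`). -/
  chartMetricCk_le : 𝓢.chartMetricCk B Ψ m S ≤ C
  /-- Uniform non-degeneracy of the chart metric on `S`. -/
  norm_le : ∀ x ∈ S, ∀ v : E4, ‖v‖ ≤ C * ‖𝓢.chartMetric B Ψ x v‖
  /-- The coordinate slabs are uniformly spacelike on `S`. -/
  sq_norm_le : ∀ x ∈ S, ∀ v : E4, v 0 = 0 → ‖v‖ ^ 2 ≤ C * 𝓢.chartMetric B Ψ x v v

variable {𝓢 B}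

/-- Uniform control passes to subsets. [folklore] -/
theorem IsUniformlyRegularOn.mono {Ψ : B.domain → 𝓢.carrier} {m : ℕ} {C : ℝ≥0}
    {S T : Set B.domain} (h : 𝓢.IsUniformlyRegularOn B Ψ m C S) (hT : T ⊆ S) :
    𝓢.IsUniformlyRegularOn B Ψ m C T where
  chartMetricCk_le := (𝓢.chartMetricCk_mono B Ψ m hT).trans h.chartMetricCk_le
  norm_le x hx := h.norm_le x (hT hx)
  sq_norm_le x hx := h.sq_norm_le x (hT hx)

/-- Uniform control in `C^m` implies uniform control in `C^{m'}` for `m' ≤ m`. [folklore] -/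
theorem IsUniformlyRegularOn.of_le {Ψ : B.domain → 𝓢.carrier} {m m' : ℕ} {C : ℝ≥0}
    {S : Set B.domain} (h : 𝓢.IsUniformlyRegularOn B Ψ m C S) (hm : m' ≤ m) :
    𝓢.IsUniformlyRegularOn B Ψ m' C S where
  chartMetricCk_le := (𝓢.chartMetricCk_mono_right B Ψ hm S).trans h.chartMetricCk_le
  norm_le := h.norm_le
  sq_norm_le := h.sq_norm_le

end Spacetime

/-! ### The hypothesis structure -/

/-- **Hypothesis structure: an asymptotically stationary exhaustion of the region
`O ⊆ 𝓢.carrier`, in `Cᵏ`** — "the exterior is asymptotically stationary in `Cᵏ`, exhaustively"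
(route `FinalStateConjecture/TwoBoundarySqueeze`; no printed formulation exists, this is the
consequence-form rendering in the style of `FinalStateDecomposition`, see the module docstring).
Data: `N` near charts `nearChart i : Uᵢ → 𝓢.carrier` and one far chart `farChart : U₀ → 𝓢.carrier`
on open domains of `E4`, bookkept by `Minkowski.backgroundOn` (time `x⁰`, radius `|x̲|`, reference
`η` — so `∂₀` of the deviation is `∂₀` of `Ψ^* g`), all late-time charts into `O` after a common
`τ₀`; (a) UNIFORM CONTROL (`Spacetime.IsUniformlyRegularOn`, in `C^{k+1}`, one constant,
eventually in `τ`) and (b) STATIONARITY (`Cᵏ` sup norm of `∂₀ (Ψ^* g)` tends to `0`) on every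
truncated slab `{x⁰ = τ, |x̲| ≤ R}` of each near chart and on the full slabs `{x⁰ = τ} ∩ U₀` of the
far chart; (c) EXHAUSTION: near-zone radii `Rᵢ(τ)` along which (a), (b) still hold such that for
every chart time `τ₁ > τ₀` every point of `O` outside the certified late region (far image of
`{x⁰ > τ₁}`, near images of `{x⁰ > τ₁, |x̲| ≤ Rᵢ(x⁰)}`) lies in the causal past of the certified slab
(far image of `{x⁰ = τ₁}`, near images of `{x⁰ = τ₁, |x̲| ≤ Rᵢ(τ₁)}`) — the covering clause of
`Summit.FinalStateConjecture.HasExhaustiveCharts`. Wald 1984, Ch. 12 ("settle down to a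
stationary final state"); Alexakis–Schlue 2018, Thm. 1.1; DHRT arXiv:2104.08222, §1.
[cite: Wald1984, Ch. 12] -/
structure AsymptoticallyStationaryExhaustion (𝓢 : Spacetime.{u} 4) (O : Set 𝓢.carrier)
    (k : ℕ) where
  /-- The number of near (bounded-radius) charts. -/
  N : ℕ
  /-- The coordinate domain `Uᵢ ⊆ E4` of near chart `i`. -/
  nearDomain : Fin N → Opens E4
  /-- The coordinate domain `U₀ ⊆ E4` of the far chart. -/
  farDomain : Opens E4
  /-- The common initial late time `τ₀` of all charts. -/
  τ₀ : ℝ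
  /-- Near chart `i`. -/
  nearChart : ∀ i, nearDomain i → 𝓢.carrier
  /-- The far chart. -/
  farChart : farDomain → 𝓢.carrier
  /-- Each near chart is a late-time chart into `O` after `τ₀` (time `x⁰`). -/
  isLateChart_near : ∀ i,
    𝓢.IsLateChart (Minkowski.backgroundOn (nearDomain i)) O τ₀ (nearChart i)
  /-- The far chart is a late-time chart into `O` after `τ₀` (time `x⁰`). -/
  isLateChart_far : 𝓢.IsLateChart (Minkowski.backgroundOn farDomain) O τ₀ farChart
  /-- (a), near: for every `R`, uniform control in `C^{k+1}` on the truncated slabs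
  `{x⁰ = τ, |x̲| ≤ R}`, eventually in `τ`, with one constant. -/
  exists_isUniformlyRegularOn_near : ∀ i (R : ℝ), ∃ C : ℝ≥0, ∀ᶠ τ in atTop,
    𝓢.IsUniformlyRegularOn (Minkowski.backgroundOn (nearDomain i)) (nearChart i) (k + 1) C
      ((Minkowski.backgroundOn (nearDomain i)).truncTimeSlab R τ)
  /-- (a), far: uniform control in `C^{k+1}` on the full slabs `{x⁰ = τ} ∩ U₀`, eventually. -/
  exists_isUniformlyRegularOn_far : ∃ C : ℝ≥0, ∀ᶠ τ in atTop,
    𝓢.IsUniformlyRegularOn (Minkowski.backgroundOn farDomain) farChart (k + 1) C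
      ((Minkowski.backgroundOn farDomain).timeSlab τ)
  /-- (b), near: for every `R`, the `Cᵏ` norm of `∂₀ (Ψᵢ^* g)` on `{x⁰ = τ, |x̲| ≤ R}` tends
  to `0`. -/
  tendsto_truncStationarityCk_near : ∀ i (R : ℝ), Tendsto (fun τ ↦
    𝓢.truncStationarityCk (Minkowski.backgroundOn (nearDomain i)) (nearChart i) k R τ)
      atTop (𝓝 0)
  /-- (b), far: the `Cᵏ` norm of `∂₀ (Ψ₀^* g)` on the full slab `{x⁰ = τ} ∩ U₀` tends to `0`. -/
  tendsto_stationarityCk_far : Tendsto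
    (fun τ ↦ 𝓢.stationarityCk (Minkowski.backgroundOn farDomain) farChart k τ) atTop (𝓝 0)
  /-- (c) The certified near-zone radius `Rᵢ(τ)` of near chart `i` at chart time `τ`. -/
  radius : Fin N → ℝ → ℝ
  /-- (c) Uniform control still holds along the radii `Rᵢ(τ)`. -/
  exists_isUniformlyRegularOn_radius : ∀ i, ∃ C : ℝ≥0, ∀ᶠ τ in atTop,
    𝓢.IsUniformlyRegularOn (Minkowski.backgroundOn (nearDomain i)) (nearChart i) (k + 1) C
      ((Minkowski.backgroundOn (nearDomain i)).truncTimeSlab (radius i τ) τ)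
  /-- (c) Stationarity still holds along the radii `Rᵢ(τ)`. -/
  tendsto_truncStationarityCk_radius : ∀ i, Tendsto (fun τ ↦
    𝓢.truncStationarityCk (Minkowski.backgroundOn (nearDomain i)) (nearChart i) k
      (radius i τ) τ) atTop (𝓝 0)
  /-- (c) Covering: for every chart time `τ₁ > τ₀`, the points of `O` outside the certified late
  region after `τ₁` lie in the causal past of the certified slab at `τ₁`. -/
  diff_subset_causalPast : ∀ τ₁ : ℝ, τ₀ < τ₁ →
    O \ (farChart '' (Minkowski.backgroundOn farDomain).lateRegion τ₁ ∪
        ⋃ i, nearChart i '' {x | τ₁ < (Minkowski.backgroundOn (nearDomain i)).time x.1 ∧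
          (Minkowski.backgroundOn (nearDomain i)).radius x.1 ≤
            radius i ((Minkowski.backgroundOn (nearDomain i)).time x.1)}) ⊆
      𝓢.metric.causalPast 𝓢.timeOrientation
        (farChart '' (Minkowski.backgroundOn farDomain).timeSlab τ₁ ∪
          ⋃ i, nearChart i ''
            (Minkowski.backgroundOn (nearDomain i)).truncTimeSlab (radius i τ₁) τ₁)

namespace AsymptoticallyStationaryExhaustion

variable {𝓢 : Spacetime.{u} 4} {O : Set 𝓢.carrier} {k : ℕ}

/-- The flat bookkeeping background of near chart `i` (`Minkowski.backgroundOn Uᵢ`). [folklore] -/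
def nearBackground (e : AsymptoticallyStationaryExhaustion 𝓢 O k) (i : Fin e.N) :
    ModelBackground :=
  Minkowski.backgroundOn (e.nearDomain i)

/-- The flat bookkeeping background of the far chart (`Minkowski.backgroundOn U₀`). [folklore] -/
def farBackground (e : AsymptoticallyStationaryExhaustion 𝓢 O k) : ModelBackground :=
  Minkowski.backgroundOn e.farDomain

/-- The **near zone** of chart `i`: the image of its late region `{x⁰ > τ₀} ∩ Uᵢ`. [folklore] -/
def nearZone (e : AsymptoticallyStationaryExhaustion 𝓢 O k) (i : Fin e.N) : Set 𝓢.carrier :=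
  e.nearChart i '' (e.nearBackground i).lateRegion e.τ₀

/-- The **far zone**: the image of the late far domain `{x⁰ > τ₀} ∩ U₀`. [folklore] -/
def farZone (e : AsymptoticallyStationaryExhaustion 𝓢 O k) : Set 𝓢.carrier :=
  e.farChart '' e.farBackground.lateRegion e.τ₀

/-- The **charted late region**: far zone and all near zones (cf.
`FinalStateDecomposition.charted`). [folklore] -/
def charted (e : AsymptoticallyStationaryExhaustion 𝓢 O k) : Set 𝓢.carrier :=
  e.farZone ∪ ⋃ i, e.nearZone i

/-- The **certified late region after chart time `τ₁`**: far image of `{x⁰ > τ₁}` and near images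
of the growing near zones `{x⁰ > τ₁, |x̲| ≤ Rᵢ(x⁰)}` (cf. `Summit.FinalStateConjecture.certifiedLate`).
[cite: DafermosLuk2017, Conjecture 1] -/
def certifiedLate (e : AsymptoticallyStationaryExhaustion 𝓢 O k) (τ₁ : ℝ) : Set 𝓢.carrier :=
  e.farChart '' e.farBackground.lateRegion τ₁ ∪
    ⋃ i, e.nearChart i '' {x | τ₁ < (e.nearBackground i).time x.1 ∧
      (e.nearBackground i).radius x.1 ≤ e.radius i ((e.nearBackground i).time x.1)}

/-- The **certified slab at chart time `τ₁`**: far image of `{x⁰ = τ₁}` and near images of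
`{x⁰ = τ₁, |x̲| ≤ Rᵢ(τ₁)}` (cf. `Summit.FinalStateConjecture.certifiedSlab`).
[cite: DafermosLuk2017, Conjecture 1] -/
def certifiedSlab (e : AsymptoticallyStationaryExhaustion 𝓢 O k) (τ₁ : ℝ) : Set 𝓢.carrier :=
  e.farChart '' e.farBackground.timeSlab τ₁ ∪
    ⋃ i, e.nearChart i '' (e.nearBackground i).truncTimeSlab (e.radius i τ₁) τ₁

/-- Clause (c) restated: uncertified points of `O` lie in `J⁻` of the certified slab, for every
chart time `τ₁ > τ₀`. [cite: DafermosLuk2017, Conjecture 1] -/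
theorem diff_certifiedLate_subset_causalPast (e : AsymptoticallyStationaryExhaustion 𝓢 O k)
    {τ₁ : ℝ} (h : e.τ₀ < τ₁) :
    O \ e.certifiedLate τ₁ ⊆ 𝓢.metric.causalPast 𝓢.timeOrientation (e.certifiedSlab τ₁) :=
  e.diff_subset_causalPast τ₁ h

/-- Each near zone lies in `O`. [folklore] -/
theorem nearZone_subset (e : AsymptoticallyStationaryExhaustion 𝓢 O k) (i : Fin e.N) :
    e.nearZone i ⊆ O :=
  (e.isLateChart_near i).image_subset

/-- The far zone lies in `O`. [folklore] -/
theorem farZone_subset (e : AsymptoticallyStationaryExhaustion 𝓢 O k) : e.farZone ⊆ O :=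
  e.isLateChart_far.image_subset

/-- The charted late region lies in `O`. [folklore] -/
theorem charted_subset (e : AsymptoticallyStationaryExhaustion 𝓢 O k) : e.charted ⊆ O :=
  union_subset e.farZone_subset (iUnion_subset e.nearZone_subset)

/-- After `τ₀`, certified late regions are charted. [folklore] -/
theorem certifiedLate_subset_charted (e : AsymptoticallyStationaryExhaustion 𝓢 O k) {τ₁ : ℝ}
    (h : e.τ₀ ≤ τ₁) : e.certifiedLate τ₁ ⊆ e.charted := by
  refine union_subset_union (image_mono (e.farBackground.lateRegion_mono h))
    (iUnion_mono fun i ↦ image_mono fun x hx ↦ ?_)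
  exact lt_of_le_of_lt h hx.1

/-- An asymptotically stationary exhaustion in `Cᵏ'` is one in `Cᵏ` for `k ≤ k'`, **with the same
charts and radii** (all norms are monotone in the order). [folklore] -/
def ofLE {k k' : ℕ} (e : AsymptoticallyStationaryExhaustion 𝓢 O k') (h : k ≤ k') :
    AsymptoticallyStationaryExhaustion 𝓢 O k where
  N := e.N
  nearDomain := e.nearDomain
  farDomain := e.farDomain
  τ₀ := e.τ₀
  nearChart := e.nearChart
  farChart := e.farChart
  isLateChart_near := e.isLateChart_near
  isLateChart_far := e.isLateChart_far
  exists_isUniformlyRegularOn_near i R := by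
    obtain ⟨C, hC⟩ := e.exists_isUniformlyRegularOn_near i R
    exact ⟨C, hC.mono fun τ hτ ↦ hτ.of_le (Nat.succ_le_succ h)⟩
  exists_isUniformlyRegularOn_far := by
    obtain ⟨C, hC⟩ := e.exists_isUniformlyRegularOn_far
    exact ⟨C, hC.mono fun τ hτ ↦ hτ.of_le (Nat.succ_le_succ h)⟩
  tendsto_truncStationarityCk_near i R :=
    tendsto_of_tendsto_of_tendsto_of_le_of_le tendsto_const_nhds
      (e.tendsto_truncStationarityCk_near i R) (fun _ ↦ zero_le)
      fun _ ↦ 𝓢.truncStationarityCk_mono_right _ _ h _ _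
  tendsto_stationarityCk_far :=
    tendsto_of_tendsto_of_tendsto_of_le_of_le tendsto_const_nhds e.tendsto_stationarityCk_far
      (fun _ ↦ zero_le) fun _ ↦ 𝓢.stationarityCk_mono_right _ _ h _
  radius := e.radius
  exists_isUniformlyRegularOn_radius i := by
    obtain ⟨C, hC⟩ := e.exists_isUniformlyRegularOn_radius i
    exact ⟨C, hC.mono fun τ hτ ↦ hτ.of_le (Nat.succ_le_succ h)⟩
  tendsto_truncStationarityCk_radius i :=
    tendsto_of_tendsto_of_tendsto_of_le_of_le tendsto_const_nhds
      (e.tendsto_truncStationarityCk_radius i) (fun _ ↦ zero_le)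
      fun _ ↦ 𝓢.truncStationarityCk_mono_right _ _ h _ _
  diff_subset_causalPast := e.diff_subset_causalPast

/-- Lowering the order does not change the charted late region. [folklore] -/
@[simp]
theorem charted_ofLE {k k' : ℕ} (e : AsymptoticallyStationaryExhaustion 𝓢 O k') (h : k ≤ k') :
    (e.ofLE h).charted = e.charted :=
  rfl

end AsymptoticallyStationaryExhaustion

/-! ### Over a Cauchy development: the self-determined exterior -/

namespace CauchyDevelopment

variable {X : Type u} [TopologicalSpace X] [ChartedSpace E3 X] [IsManifold (𝓡 3) ∞ X]
  [ConnectedSpace X] {D : InitialDataSet (𝓡 3) X}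

/-- **The exterior of the Cauchy development `𝒟` is asymptotically stationary in `Cᵏ`,
exhaustively**: some region `O` carries an asymptotically stationary exhaustion `e` in `Cᵏ`
(`AsymptoticallyStationaryExhaustion`: finitely many uniformly controlled late charts from open
domains of `E4` on which `∂₀ (Ψ^* g) → 0` in `Cᵏ`, exhausting `O`) and `O` **is** the exterior its
charts determine, `O = J⁺(ι X) ∩ I⁻(e.charted)` (`exteriorOf`; the device of
`Development.SettlesToKerrFamily`). The intended output of the observability squeeze from `𝓘⁺` and
`𝓗⁺` and the hypothesis of the rigidity step of route `FinalStateConjecture/TwoBoundarySqueeze`;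
folklore expectation: Wald 1984, Ch. 12; infinite-window vacuum theorem: Alexakis–Schlue 2018,
Thm. 1.1. [cite: Wald1984, Ch. 12] -/
def HasAsymptoticallyStationaryExhaustion (𝒟 : CauchyDevelopment D) (k : ℕ) : Prop :=
  ∃ (O : Set 𝒟.carrier) (e : AsymptoticallyStationaryExhaustion 𝒟.toSpacetime O k),
    O = 𝒟.exteriorOf e.charted

/-- Asymptotic stationarity in `Cᵏ'` implies it in `Cᵏ` for `k ≤ k'` (same charts, same region).
[folklore] -/
theorem HasAsymptoticallyStationaryExhaustion.of_le {𝒟 : CauchyDevelopment D} {k k' : ℕ}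
    (h : 𝒟.HasAsymptoticallyStationaryExhaustion k') (hk : k ≤ k') :
    𝒟.HasAsymptoticallyStationaryExhaustion k := by
  obtain ⟨O, e, he⟩ := h
  exact ⟨O, e.ofLE hk, by rw [AsymptoticallyStationaryExhaustion.charted_ofLE]; exact he⟩

/-- The region carrying an exhaustion contains the charted late region and lies to the causal
future of the data (nothing is said about the past or about black-hole interiors). [folklore] -/
theorem HasAsymptoticallyStationaryExhaustion.exists_subset {𝒟 : CauchyDevelopment D} {k : ℕ}
    (h : 𝒟.HasAsymptoticallyStationaryExhaustion k) :
    ∃ (O : Set 𝒟.carrier) (e : AsymptoticallyStationaryExhaustion 𝒟.toSpacetime O k),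
      e.charted ⊆ O ∧ O ⊆ 𝒟.metric.causalFuture 𝒟.timeOrientation (range 𝒟.embed) := by
  obtain ⟨O, e, he⟩ := h
  exact ⟨O, e, e.charted_subset, he ▸ 𝒟.exteriorOf_subset_causalFuture _⟩

end CauchyDevelopment

end Literature.Geometry.Lorentzian

end
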